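import Summits.QuantumFields.YangMills.Theorems.FluctuationComparisonRegPrIntLS2BetaLiftLadderPerBlockRow
import Summits.QuantumFields.YangMills.Theorems.FluctuationComparisonRegPrIntLS2BetaFaceDiscrepancyOfLetters
import HarnessLib

/-!
# S2β · Q11k — THE PER-`B` ONE-PROFILE ROW FROM NAMED LETTERS ONLY: engine hypotheses + arc profile + READ nesting + `ρκ`, `aκ`, `mR`, `ρ̃` (ONE name; `SU(2)`, `blockAvg ℰ`)

Cell `ym3-torus` (rung R3 = continuum `SU(2)` YM₃ on T³ at fixed lattice data — NOT d = 4, NOT infinite volume, NOT a mass gap, NOT Clay).  Width seat `ym3-torus-px5` (gen 23);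
crux `stmt-QuantumFields-20520`, LINE g18-1 S2β; architect RULING (3) 19:37:59Z «px5 assembles the per-`B` row».  ✓p833084 `sq_pi_norm_trunc_le_perBlock` (the row, with the two sources
`hρ̃`, `hface`) ∘ ✓∕⧗Q11j `hface_of_letters` (`hface` from `ρκ`, `aκ`, `mR`, `ρ̃` via ✓p834123 ∘ ✓p834378): THIS FILE is the composition px21 g25's kernel dock cert 96447bd7 exhibited as an
`example`, stated as a THEOREM with ONE plaquette binder covering both shapes (the bond's block AND its `b.dir`-neighbour) and the two sign facts `0 ≤ ρκ`, `0 ≤ aκ`: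
**`‖𝟙_{pS}·logVec η_j‖² ≤ (1+κ)(11∕10·L⁻¹)²·‖𝟙_{pT}·logVec η_{j+1}‖² + (1+κ⁻¹)·s²`**, `s := sF + (π∕2)·((d−1)·((L−1)∕2))·ρ̃`, `sF := (π∕2)·((ρκ + 2·aκ·(((L−1)∕2+1)·mR)) + ((d−1)·((L−1)∕2))·(1+2·((L−1)∕2))·ρ̃)`.
`--kind proof --supports stmt-QuantumFields-20520 --as helper`, count-neutral, DEFINITION-FREE (0 `def`, 0 `instance`, 0 `notation`, 0 `sorry`, default heartbeats).

WHAT IS PROVED (sorry-free).  ★★★`sq_pi_norm_trunc_le_perBlock_of_letters`.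

HONEST SCOPE.  A junction of landed lemmas; nothing of Bałaban's analysis is asserted or proved; the letters `ρκ`∕`aκ`∕`mR`∕`ρ̃` (px16∕px13 curl currency, small-field class, arc profile, px12 (d)),
(T3)(T4)(T5), `hcomm`, `σ ≤ 1∕4`, READ′ nesting and the tower re-indexing∕budgets are HYPOTHESES or others'; rows UNDISCHARGED at the tower; (ST″)∕LOC″, «MULT♭-ax»∕«CRIT-ax», (D-stage), h3,
GAP♯∘ (`stub_uniformFibreGapOrbit`, registry 3732b7df UNTOUCHED, 0∕5), S2β, the five registered stubs, 20520, 19936, 19200, `YM3TorusSU2` NOT proved; no summit statement is proved by a helper;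
rung R3 — NOT d = 4, NOT infinite volume, NOT a mass gap, NOT Clay; the Yang–Mills mass gap is NOT proved.

References: T. Bałaban, CMP **102** (1985) 277–309 [Balaban1985RegularSpaces] ((1.19) p.79, (1.29) p.81); CMP **109** (1987) 249–301 [Balaban1987RG1] ((0.3)–(0.4) p.252); CMP **122**
(1989) 355–392 [Balaban1989LargeFieldII] (p.382).
-/

set_option autoImplicit false

namespace Summit.QuantumFields.YangMills.Theorems.FluctuationComparisonRegPrIntLS2BetaLiftLadderPerBlockRowOfLetters

open scoped Real
open Literature.MathematicalPhysics.QuantumLattice (su2Quat)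
open Literature.MathematicalPhysics.QuantumFieldTheory.Balaban1983to89
open Literature.MathematicalPhysics.QuantumFieldTheory.Balaban1983to89.T4Continuum
open Literature.MathematicalPhysics.QuantumFieldTheory.Balaban1983to89.BlockAveraging
open Literature.MathematicalPhysics.QuantumFieldTheory.Balaban1983to89.AveragingRT
open Literature.MathematicalPhysics.QuantumFieldTheory.Balaban1983to89.B10Eq47AxialChi
open B10Eq27TorusAxialLog (rel transl axialT)
open T4CubeChartGnomonic (SU2)
open T4HaarSU2ExpChart (expPoint)
open T4ExpWindowSmallField (logVec)
open Summit.QuantumFields.YangMills.Theorems.FluctuationComparisonRegPrIntLS2BetaLiftLadderPerBlockRow (sq_pi_norm_trunc_le_perBlock)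
open Summit.QuantumFields.YangMills.Theorems.FluctuationComparisonRegPrIntLS2BetaFaceDiscrepancyOfLetters (hface_of_letters)

variable {P : Params}

/-- ★★★ **THE PER-`B` ONE-PROFILE ROW FROM NAMED LETTERS ONLY.**  Under px20's engine hypotheses (`wt`∕`lift`∕`g`∕`g₀`∕`U₀` readings (T3)(T4)(T5), `hU₀`, `2 ≤ L`, arc profile `σ ≤ 1∕4`,
READ nesting `hnest`), the commutator letter `hcomm`, and the four SOURCES on the `pS`-bonds — `ρκ`, `aκ`, `mR` at the face-crossing bonds, `ρ̃` on the plaquettes of the bonds' blocks and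
their neighbours:  `‖𝟙_{pS}·logVec η_j‖² ≤ (1+κ)(11∕10·L⁻¹)²·‖𝟙_{pT}·logVec η_{j+1}‖² + (1+κ⁻¹)·(sF + (π∕2)·((d−1)·((L−1)∕2))·ρ̃)²` with
`sF = (π∕2)·((ρκ + 2·aκ·(((L−1)∕2+1)·mR)) + ((d−1)·((L−1)∕2))·(1+2·((L−1)∕2))·ρ̃)`. [cite: Balaban1985RegularSpaces, (1.19) p.79, (1.29) p.81; Balaban1987RG1, (0.3)-(0.4) p.252; Balaban1989LargeFieldII, p.382] -/
theorem sq_pi_norm_trunc_le_perBlock_of_letters (ℰ : LoopAverage SU2) {j : ℕ} (hj : j + 1 ≤ P.m + P.K)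
    (wt : (i : ℕ) → PBond P i → PBond P (i + 1) → ℝ) (lift : (i : ℕ) → GaugeField P (i + 1) SU2 → GaugeField P i SU2)
    (g g₀ : (i : ℕ) → Site P i → SU2) (U U₁ U₀ : GaugeField P 0 SU2)
    (hwt : ∀ b e, wt j b e = if e.dir = b.dir ∧ (b.src b.dir - emb e.src b.dir).val < P.L then
      ∏ ν ∈ Finset.univ.erase b.dir, max 0 (1 - ((rel (emb e.src) b.src ν).natAbs : ℝ) / P.L) else 0)
    (hlift : ∀ (X : GaugeField P (j + 1) SU2) (b : PBond P j), lift j X b = expPoint (∑ e, wt j b e • ((P.L : ℝ)⁻¹ • logVec (su2Quat (X e)))))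
    (hT3 : ∀ X : GaugeField P 0 SU2, Averaging.iter (fun i => blockAvg (P := P) (j := i) ℰ) j (GaugeField.gaugeAct (g 0) X) =
      GaugeField.gaugeAct (g j) (Averaging.iter (fun i => blockAvg (P := P) (j := i) ℰ) j X))
    (hT3s : ∀ X : GaugeField P 0 SU2, Averaging.iter (fun i => blockAvg (P := P) (j := i) ℰ) (j + 1) (GaugeField.gaugeAct (g 0) X) =
      GaugeField.gaugeAct (g (j + 1)) (Averaging.iter (fun i => blockAvg (P := P) (j := i) ℰ) (j + 1) X))
    (hT3' : ∀ X : GaugeField P 0 SU2, Averaging.iter (fun i => blockAvg (P := P) (j := i) ℰ) j (GaugeField.gaugeAct (g₀ 0) X) =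
      GaugeField.gaugeAct (g₀ j) (Averaging.iter (fun i => blockAvg (P := P) (j := i) ℰ) j X))
    (hT3s' : ∀ X : GaugeField P 0 SU2, Averaging.iter (fun i => blockAvg (P := P) (j := i) ℰ) (j + 1) (GaugeField.gaugeAct (g₀ 0) X) =
      GaugeField.gaugeAct (g₀ (j + 1)) (Averaging.iter (fun i => blockAvg (P := P) (j := i) ℰ) (j + 1) X))
    (hU₀ : U₀ = GaugeField.gaugeAct (fun x => (g 0 x)⁻¹ * g₀ 0 x) U₁)
    (hT4 : ∀ x, axialT (GaugeField.gaugeAct (g j) (Averaging.iter (fun i => blockAvg (P := P) (j := i) ℰ) j U)) (emb (blockOf x)) x =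
      axialT (lift j (GaugeField.gaugeAct (g (j + 1)) (Averaging.iter (fun i => blockAvg (P := P) (j := i) ℰ) (j + 1) U))) (emb (blockOf x)) x)
    (hT4' : ∀ x, axialT (GaugeField.gaugeAct (g₀ j) (Averaging.iter (fun i => blockAvg (P := P) (j := i) ℰ) j U₁)) (emb (blockOf x)) x =
      axialT (lift j (GaugeField.gaugeAct (g₀ (j + 1)) (Averaging.iter (fun i => blockAvg (P := P) (j := i) ℰ) (j + 1) U₁))) (emb (blockOf x)) x)
    (hT5 : (blockAvg (P := P) (j := j) ℰ).avg (GaugeField.gaugeAct (g j) (Averaging.iter (fun i => blockAvg (P := P) (j := i) ℰ) j U)) =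
      GaugeField.gaugeAct (g (j + 1)) (Averaging.iter (fun i => blockAvg (P := P) (j := i) ℰ) (j + 1) U))
    (hT5' : (blockAvg (P := P) (j := j) ℰ).avg (GaugeField.gaugeAct (g₀ j) (Averaging.iter (fun i => blockAvg (P := P) (j := i) ℰ) j U₁)) =
      GaugeField.gaugeAct (g₀ (j + 1)) (Averaging.iter (fun i => blockAvg (P := P) (j := i) ℰ) (j + 1) U₁))
    (hcomm : ∀ x y : SU2, dist1 (x * y * x⁻¹ * y⁻¹) ≤ 2 * dist1 x * dist1 y)
    (hL2 : 2 ≤ P.L) {σ : ℝ} (hσ4 : σ ≤ 1 / 4)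
    (pS : PBond P j → Prop) [DecidablePred pS] (pT : PBond P (j + 1) → Prop) [DecidablePred pT]
    (hnest : ∀ b, pS b → ∀ e, wt j b e ≠ 0 → pT e)
    (hσ : ∀ e, pT e → ‖logVec (su2Quat (GaugeField.gaugeAct (g (j + 1)) (Averaging.iter (fun i => blockAvg (P := P) (j := i) ℰ) (j + 1) U) e))‖ ≤ σ)
    (hσ' : ∀ e, pT e → ‖logVec (su2Quat (GaugeField.gaugeAct (g₀ (j + 1)) (Averaging.iter (fun i => blockAvg (P := P) (j := i) ℰ) (j + 1) U₁) e))‖ ≤ σ)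
    {ρκ aκ mR ρt : ℝ} (hρκ0 : 0 ≤ ρκ) (haκ0 : 0 ≤ aκ) (hmR : 0 ≤ mR) (hρ0 : 0 ≤ ρt)
    (hκrel : ∀ b : PBond P j, pS b → blockOf (b.src.shift b.dir) ≠ blockOf b.src →
      dist1 (corr ℰ (GaugeField.gaugeAct (g j) (Averaging.iter (fun i => blockAvg (P := P) (j := i) ℰ) j U)) ⟨blockOf b.src, b.dir⟩ *
        (corr ℰ (GaugeField.gaugeAct (g₀ j) (Averaging.iter (fun i => blockAvg (P := P) (j := i) ℰ) j U₁)) ⟨blockOf b.src, b.dir⟩)⁻¹) ≤ ρκ)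
    (hκabs : ∀ b : PBond P j, pS b → blockOf (b.src.shift b.dir) ≠ blockOf b.src →
      dist1 (corr ℰ (GaugeField.gaugeAct (g₀ j) (Averaging.iter (fun i => blockAvg (P := P) (j := i) ℰ) j U₁)) ⟨blockOf b.src, b.dir⟩) ≤ aκ)
    (hR : ∀ b : PBond P j, pS b → blockOf (b.src.shift b.dir) ≠ blockOf b.src →
      dist1 (lift j (GaugeField.gaugeAct (g (j + 1)) (Averaging.iter (fun i => blockAvg (P := P) (j := i) ℰ) (j + 1) U))
            ⟨transl (emb (blockOf b.src)) (fun ν => if ν = b.dir then (((P.L - 1) / 2 : ℕ) : ℤ) else 0), b.dir⟩ *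
          (lift j (GaugeField.gaugeAct (g₀ (j + 1)) (Averaging.iter (fun i => blockAvg (P := P) (j := i) ℰ) (j + 1) U₁))
            ⟨transl (emb (blockOf b.src)) (fun ν => if ν = b.dir then (((P.L - 1) / 2 : ℕ) : ℤ) else 0), b.dir⟩)⁻¹) ≤ mR)
    (hρ : ∀ q : Plaq P j, (∃ b : PBond P j, pS b ∧ (blockOf q.src = blockOf b.src ∨ blockOf q.src = (blockOf b.src).shift b.dir)) →
      dist1 ((GaugeField.plaqHol (fun b => lift j (GaugeField.gaugeAct (g (j + 1)) (Averaging.iter (fun i => blockAvg (P := P) (j := i) ℰ) (j + 1) U)) b *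
            (lift j (GaugeField.gaugeAct (g₀ (j + 1)) (Averaging.iter (fun i => blockAvg (P := P) (j := i) ℰ) (j + 1) U₁)) b)⁻¹ *
          GaugeField.gaugeAct (g₀ j) (Averaging.iter (fun i => blockAvg (P := P) (j := i) ℰ) j U₁) b : GaugeField P j SU2) q)⁻¹ *
        GaugeField.plaqHol (GaugeField.gaugeAct (g j) (Averaging.iter (fun i => blockAvg (P := P) (j := i) ℰ) j U)) q) ≤ ρt)
    {κ : ℝ} (hκ : 0 < κ) :
    ‖(fun b : PBond P j => if pS b then
        logVec (su2Quat (Averaging.iter (fun i => blockAvg (P := P) (j := i) ℰ) j U b * (Averaging.iter (fun i => blockAvg (P := P) (j := i) ℰ) j U₀ b)⁻¹)) else 0)‖ ^ 2 ≤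
      (1 + κ) * (11 / 10 * (P.L : ℝ)⁻¹) ^ 2 *
        ‖(fun e : PBond P (j + 1) => if pT e then
          logVec (su2Quat (Averaging.iter (fun i => blockAvg (P := P) (j := i) ℰ) (j + 1) U e * (Averaging.iter (fun i => blockAvg (P := P) (j := i) ℰ) (j + 1) U₀ e)⁻¹)) else 0)‖ ^ 2 +
      (1 + κ⁻¹) * ((π / 2 * ((ρκ + 2 * aκ * ((((P.L - 1) / 2 + 1 : ℕ) : ℝ) * mR)) +
          (((P.d - 1) * ((P.L - 1) / 2) : ℕ) : ℝ) * ((1 + 2 * (((P.L - 1) / 2 : ℕ) : ℝ)) * ρt))) +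
        π / 2 * ((((P.d - 1) * ((P.L - 1) / 2) : ℕ) : ℝ) * ρt)) ^ 2 := by
  have hsF0 : 0 ≤ π / 2 * ((ρκ + 2 * aκ * ((((P.L - 1) / 2 + 1 : ℕ) : ℝ) * mR)) +
      (((P.d - 1) * ((P.L - 1) / 2) : ℕ) : ℝ) * ((1 + 2 * (((P.L - 1) / 2 : ℕ) : ℝ)) * ρt)) := by positivity
  exact sq_pi_norm_trunc_le_perBlock (fun i => blockAvg (P := P) (j := i) ℰ) hj wt lift g g₀ U U₁ U₀ hwt hlift hT3 hT3s hT3' hT3s' hU₀ hT4 hT4' hL2 hσ4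
    pS pT hnest hσ hσ' hρ0 (fun q hq => hρ q (by obtain ⟨b, hb, hq⟩ := hq; exact ⟨b, hb, Or.inl hq⟩)) hsF0
    (hface_of_letters ℰ hj wt lift g g₀ U U₁ hwt hlift hT4 hT4' hT5 hT5' hcomm pS hmR hρ0 hκrel hκabs hR
      (fun b hb q hq => hρ q ⟨b, hb, hq⟩)) hκ

end Summit.QuantumFields.YangMills.Theorems.FluctuationComparisonRegPrIntLS2BetaLiftLadderPerBlockRowOfLetters
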